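import Summits.ResolutionOfSingularities.ResolutionOfSingularities.Theorems.EquisingularLiftEquisingularLiftNatResidueHypDefs8
import Summits.ResolutionOfSingularities.ResolutionOfSingularities.Theorems.EquisingularLiftEquisingularLiftNatLetteredPrefixResolution
import Summits.ResolutionOfSingularities.ResolutionOfSingularities.Theorems.EquisingularLiftEquisingularLiftNatLetteredPointStepSupplier
import Summits.ResolutionOfSingularities.ResolutionOfSingularities.Theorems.EquisingularLiftEquisingularLiftNatPairRoundSupplier
import Summits.ResolutionOfSingularities.ResolutionOfSingularities.Theorems.EquisingularLiftEquisingularLiftNatCrossedLetterTransport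
import Summits.ResolutionOfSingularities.ResolutionOfSingularities.Theorems.EquisingularLiftEquisingularLiftNatCurveRoundExceptionalLetter
import Summits.ResolutionOfSingularities.ResolutionOfSingularities.Theorems.EquisingularLiftEquisingularLiftNatOpeningSupplier2
import Summits.ResolutionOfSingularities.ResolutionOfSingularities.Theorems.EquisingularLiftEquisingularLiftNatKeyLetterPointStep
import Summits.ResolutionOfSingularities.ResolutionOfSingularities.Theorems.EquisingularLiftEquisingularLiftNatKeyLetterCarrierRoundOfOrder
import Summits.ResolutionOfSingularities.ResolutionOfSingularities.Theorems.EquisingularLiftEquisingularLiftNatCrossedLetterClausesPrime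
import Summits.ResolutionOfSingularities.ResolutionOfSingularities.Theorems.EquisingularLiftEquisingularLiftNatOpeningBirth
import HarnessLib

/-!
# [OURS · L1 W4.5(b) · EL♮(3) · WIDTH TABLE D5 «IMMATURE HOST (key letter)», row D5-5] RUNG⁶ `nd_leaves_rung_threeP6`
# = the K5⁶ lettered-prefix engine ✓ `target_elnat_of_letteredPrefixResolution` (p669625) applied to the K6-2P6 junction over the blob
# `IsoHypReachNDLeavesP6` (✓ p671016 `…NatResidueHypDefs8`), the six upstairs suppliers BY NAME

res-L1-w45b-lead-2 g8 (text owner; RUNG⁶ pen per desk l.83800), after res-L1-w45b-idea-1 g27's junction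
`Cruxes/EquisingularLiftNatThree/NDLeavesRungK6JunctionDefs8.lean` ccfef8ae5511c2e3 (§B/§D copied VERBATIM below — Cruxes modules are not build targets) and
res-type-027 g20's recipe (STATUS 2026-08-28 l.83702).  OURS · counted 0 · AI-written, weaker than expert review · nothing of [Hironaka2017] is asserted
(a candidate under adjudication) · **EL♮(3) is NOT proved by this file**: it is the RUNG of the 40th registration (ISO CUT P ↦ P6, REPLACE form), i.e.
the theorem the derived old residue `stub_elnat_three_isolated_nonNDLeaves` calls; the new residue `stub_elnat_three_isolated_nonNDLeaves6` stays a stub.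
No `sorry`, no new definition, no instance, no notation; standard axioms; sorry-cone of the rung = F-88 only (via the hypothesis `EmbeddedCurveLiftFact`).

WHAT.  `nd_leaves_rung_threeP6 (p) : EmbeddedCurveLiftFact → p.Prime → ∀ k [Field k] [CharP k p] [IsAlgClosed k] (H ι), hι → hH → hloc →
IsoHypReachNDLeavesP6 k 3 H ι → ELNatConclusionO k 3 H ι` — binder convention of the rungs (R-ν1)/(R-ν2)/P/P5 (the 40th texts call exactly this shape).
The 38th's rung `nd_leaves_rung_threeP` (✓ p652728) follows back from it through ✓ `isoHypReachNDLeavesP6_of_P` (the REPLACE loses nothing; not restated here — dedup).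

PROOF = pure composition (idea-1's §E probe made a theorem):
* §B/§D (idea-1, verbatim): `PrefixReachKeyLetterParam` is monotone in `Reach` and stable under ND rounds (`hQ'` of ✓ `ND.rounds_resolve` applied once to the
  collapsed motive `∃ Ls Kp, Q … Ls Kp`, round-closed by clause (Pc)); hence blob + round facts ⇒ the engine's LAST hypothesis literally
  (`letteredPrefix_end_of_isoHypReachNDLeavesP6`, reach `B‴ ∨ toric`, `ReachL := ReachTowerBQuintPrime ℙⁿ`, `LS := HyperplaneLetters`, `Open := OpeningCertKeyLetter`);
* §R the engine at `n = 3` with HSUB₁ := rung P5's `Or.elim` block VERBATIM (✓ `hsub_reachTowerBTriplePrime_of_fact_full` ∘ ✓ `inv_baseSL` on `B‴`,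
  ✓ `ND.hsub_strataLift` on toric towers), HSUB₂ := rung P5's initial-stage lettered supplier VERBATIM (✓ `hsub_reachTowerBQuintPrime_of_fact_full` p655307, seeds
  ✓ `inv_baseSL_letters` / ✓ `inv_baseS₀L_letters`, letter models ✓ `LinearLetter.exists_letter_model_le_ker` + ✓ `letter_strictTransform_of_le_ker`; `LS` is now the
  NAMED predicate `HyperplaneLetters`, δ-equal to P5's lambda), HPT⁶ := ✓ `TCPlus.hpt6_supplier k 3` (p670621), HOPEN := ✓ `TCPlus.hopen_supplier_of₂ k H ι` (stub-2 ✓ p673794, hG1C′ form) over (IN-1) ✓ `TCPlus.opening_birth k H ι` (stub-4's (B7) assembly of the joint birth over the bricks (B0) ✓ p675313 · (B2) ✓ p675042 (stub-4) · (B3) ✓ p674833 · (B4) ✓ p675170 · (B5) ✓ p675956 (res-type-027 g21) · (B6) ✓ p675837 (stub-2)), (IN-2) ✓ `TCPlus.keyInc_pointStep` (p672830), (IN-3′) ✓ `TCPlus.keyInc_carrierRound_of_order k` (p673480), (IN-4) ✓ `TCPlus.crossedLetter_clauses' k` (p673307), HPAIR :=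
  ✓ `TCPlus.hpair_supplier_of k (TCPlus.crossedLetter_transport k) (TCPlus.excLetter_birth k)` (p670305 ∘ stub-4 (CL) ✓ `…NatCrossedLetterTransport` ∘ (EB) ✓ p670919 — unconditional, stub-4 g12
  composition check), HROUND := ✓ `TCPlus.hround_seam k hFact`, round facts := ✓ `ndInvLNP_round 3 k` (p652728). [folklore; pure threading of tree theorems]
-/

set_option linter.dupNamespace false -- mandated namespace `Summit.<Summit>.<Problem>` of this single-conjunct summit

noncomputable section

open CategoryTheory CategoryTheory.Limits AlgebraicGeometry TopologicalSpace Topology IsLocalRing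
open Literature.AlgebraicGeometry.Resolution
open AlgebraicGeometry.Scheme.IdealSheafData
open Summit.ResolutionOfSingularities.ResolutionOfSingularities.Theses.EquisingularLift.Split
open Summit.ResolutionOfSingularities.ResolutionOfSingularities.Cruxes.EquisingularLift.StrataSplit

namespace Summit.ResolutionOfSingularities.ResolutionOfSingularities.Cruxes.EquisingularLiftNat.Sections

section Junction

variable {k : Type} [Field k] [IsAlgClosed k] {n : ℕ} {H : AlgebraicGeometry.Scheme.{0}}
  {ι : H ⟶ (Literature.AlgebraicGeometry.Motives.projectiveSpace n k).left}
  {Reach Reach₁ Reach₂ : ∀ (F₁ F₂ : AlgebraicGeometry.Scheme.{0}), (F₂ ⟶ F₁) → F₁ → Set F₂ → ∀ (F₉ : AlgebraicGeometry.Scheme.{0}), (F₉ ⟶ F₂) → Set F₉ → Prop}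
  {ReachL : ∀ (F₂ : AlgebraicGeometry.Scheme.{0}), (F₂ ⟶ (Literature.AlgebraicGeometry.Motives.projectiveSpace n k).left) →
      (Literature.AlgebraicGeometry.Motives.projectiveSpace n k).left → Set F₂ → List (Set F₂) → ∀ (F₉ : AlgebraicGeometry.Scheme.{0}), (F₉ ⟶ F₂) → Set F₉ → Prop}
  {LS : ∀ (F₂ : AlgebraicGeometry.Scheme.{0}), (F₂ ⟶ (Literature.AlgebraicGeometry.Motives.projectiveSpace n k).left) →
      (Literature.AlgebraicGeometry.Motives.projectiveSpace n k).left → List (Set F₂) → Prop}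
  {Open : ∀ (F₃ : AlgebraicGeometry.Scheme.{0}), (F₃ ⟶ (Literature.AlgebraicGeometry.Motives.projectiveSpace n k).left) → Set F₃ → List (Set F₃) →
      Option (Set F₃ × Set F₃ × Set F₃) → Prop}
  {F F' : AlgebraicGeometry.Scheme.{0}} {ρ : F ⟶ (Literature.AlgebraicGeometry.Motives.projectiveSpace n k).left} {T : Set F}
  {ρ' : F' ⟶ (Literature.AlgebraicGeometry.Motives.projectiveSpace n k).left} {T' : Set F'}

/-! ## §B  Junction lemmas over `PrefixReachKeyLetterParam` -/

/-- **Monotonicity in `Reach`** (a motive closed under (Pc)[`Reach₂`] is closed under (Pc)[`Reach₁`] when `Reach₁ ≤ Reach₂`). [OURS · pure logic] -/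
theorem prefixReachKeyLetterParam_mono_reach
    (hR : ∀ (F₁ F₂ : AlgebraicGeometry.Scheme.{0}) (υ : F₂ ⟶ F₁) (x : F₁) (T₂ : Set F₂) (F₉ : AlgebraicGeometry.Scheme.{0}) (β : F₉ ⟶ F₂) (T₉ : Set F₉),
      Reach₁ F₁ F₂ υ x T₂ F₉ β T₉ → Reach₂ F₁ F₂ υ x T₂ F₉ β T₉)
    (hpre : PrefixReachKeyLetterParam k n H ι Reach₁ ReachL LS Open F ρ T) :
    PrefixReachKeyLetterParam k n H ι Reach₂ ReachL LS Open F ρ T := by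
  intro Q hstart hD hPc hPL hi hO hii hHR
  refine hpre Q hstart hD ?_ hPL hi hO hii hHR
  intro F₁ F₂ ρ₁ T₁ Ls Kp x υ hx hQ hn hr hυ
  obtain ⟨h₁, h₂⟩ := hPc F₁ F₂ ρ₁ T₁ Ls Kp x υ hx hQ hn hr hυ
  exact ⟨h₁, fun F₉ β T₉ h₉ => h₂ F₉ β T₉ (hR _ _ _ _ _ _ _ _ h₉)⟩

/-- **PREFIX then ND ROUNDS ⇒ PREFIX at the resolved end**, for any `Reach ⊇ ND.ReachToric n`; `hQ'` is ✓ `ND.rounds_resolve`'s first conjunct between the prefix's END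
stage and the resolved stage.  Inside the `∀ Q`: `hQ'` applied to the COLLAPSED motive `∃ Ls Kp, Q … Ls Kp`, which is `ND.RoundClosed` by clause (Pc). [OURS · pure logic] -/
theorem prefixReachKeyLetterParam_then_rounds
    (hRT : ∀ (F₁ F₂ : AlgebraicGeometry.Scheme.{0}) (υ : F₂ ⟶ F₁) (x : F₁) (T₂ : Set F₂) (F₉ : AlgebraicGeometry.Scheme.{0}) (β : F₉ ⟶ F₂) (T₉ : Set F₉),
      ND.ReachToric n F₁ F₂ υ x T₂ F₉ β T₉ → Reach F₁ F₂ υ x T₂ F₉ β T₉)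
    (hpre : PrefixReachKeyLetterParam k n H ι Reach ReachL LS Open F ρ T)
    (hQ' : ∀ Q₃ : (∀ F₁ : AlgebraicGeometry.Scheme.{0}, (F₁ ⟶ (Literature.AlgebraicGeometry.Motives.projectiveSpace n k).left) → Set F₁ → Prop),
      ND.RoundClosed n k Q₃ → Q₃ F ρ T → Q₃ F' ρ' T') :
    PrefixReachKeyLetterParam k n H ι Reach ReachL LS Open F' ρ' T' := by
  intro Q hstart hD hPc hPL hi hO hii hHR
  refine hQ' (fun F₁ ρ₁ T₁ => ∃ (Ls : List (Set F₁)) (Kp : Option (Set F₁ × Set F₁ × Set F₁)), Q F₁ ρ₁ T₁ Ls Kp) ?_ (hpre Q hstart hD hPc hPL hi hO hii hHR)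
  intro F₁ F₂ ρ₁ T₁ x υ hx hQx hn hr hυ
  obtain ⟨Ls, Kp, hQx⟩ := hQx
  obtain ⟨h₁, h₂⟩ := hPc F₁ F₂ ρ₁ T₁ Ls Kp x υ hx hQx hn hr hυ
  exact ⟨⟨[], none, h₁⟩, fun F₉ β T₉ h₉ => ⟨[], none, h₂ F₉ β T₉ (hRT _ _ _ _ _ _ _ _ h₉)⟩⟩

/-- Both in one term: prefix at `Reach₁` + rounds ⇒ prefix at `Reach₂ ⊇ Reach₁ ∪ toric` at the resolved end. [OURS · pure logic] -/
theorem prefixReachKeyLetterParam_end_of_prefix_then_rounds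
    (hR : ∀ (F₁ F₂ : AlgebraicGeometry.Scheme.{0}) (υ : F₂ ⟶ F₁) (x : F₁) (T₂ : Set F₂) (F₉ : AlgebraicGeometry.Scheme.{0}) (β : F₉ ⟶ F₂) (T₉ : Set F₉),
      Reach₁ F₁ F₂ υ x T₂ F₉ β T₉ → Reach₂ F₁ F₂ υ x T₂ F₉ β T₉)
    (hRT : ∀ (F₁ F₂ : AlgebraicGeometry.Scheme.{0}) (υ : F₂ ⟶ F₁) (x : F₁) (T₂ : Set F₂) (F₉ : AlgebraicGeometry.Scheme.{0}) (β : F₉ ⟶ F₂) (T₉ : Set F₉),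
      ND.ReachToric n F₁ F₂ υ x T₂ F₉ β T₉ → Reach₂ F₁ F₂ υ x T₂ F₉ β T₉)
    (hpre : PrefixReachKeyLetterParam k n H ι Reach₁ ReachL LS Open F ρ T)
    (hQ' : ∀ Q₃ : (∀ F₁ : AlgebraicGeometry.Scheme.{0}, (F₁ ⟶ (Literature.AlgebraicGeometry.Motives.projectiveSpace n k).left) → Set F₁ → Prop),
      ND.RoundClosed n k Q₃ → Q₃ F ρ T → Q₃ F' ρ' T') :
    PrefixReachKeyLetterParam k n H ι Reach₂ ReachL LS Open F' ρ' T' :=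
  prefixReachKeyLetterParam_then_rounds hRT (prefixReachKeyLetterParam_mono_reach hR hpre) hQ'

/-! ## §D  The K6-2P6 junction: blob + round facts ⇒ the engine's last hypothesis -/

variable (k n H ι) in
/-- **`letteredPrefix_end_of_isoHypReachNDLeavesP6`** — from the ND ROUND FACTS (K6-2P5's `hround`; at `n = 3` ✓ `ndInvLNP_round 3 k`) and the BLOB `IsoHypReachNDLeavesP6 k n H ι`
(✓ p671016): a resolved end reached by the KEY-LETTER PREFIX for the engine's reach `B‴ ∨ toric` — literally the last hypothesis of ✓ p669625
`target_elnat_of_letteredPrefixResolution` at `ReachL := ReachTowerBQuintPrime ℙⁿ`, `LS := HyperplaneLetters`, `Open := OpeningCertKeyLetter`. [OURS · pure logic over ✓ `ND.rounds_resolve`] -/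
theorem letteredPrefix_end_of_isoHypReachNDLeavesP6 (hround : ND.RoundFacts n k (ND.NDInvCLNP n k)) (h : IsoHypReachNDLeavesP6 k n H ι) :
    ∃ (F' : AlgebraicGeometry.Scheme.{0}) (ρ' : F' ⟶ (Literature.AlgebraicGeometry.Motives.projectiveSpace n k).left) (T' : Set F'),
      PrefixReachKeyLetterParam k n H ι
          (fun F₁ F₂ υ x T₂ F₉ β T₉ => ReachTowerBTriplePrime F₁ F₂ υ x T₂ F₉ β T₉ ∨ ND.ReachToric n F₁ F₂ υ x T₂ F₉ β T₉)
          (ReachTowerBQuintPrime (Literature.AlgebraicGeometry.Motives.projectiveSpace n k).left) (HyperplaneLetters k n H ι) (OpeningCertKeyLetter k n H ι) F' ρ' T' ∧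
        Literature.AlgebraicGeometry.Resolution.Scheme.IsRegular
          (AlgebraicGeometry.Scheme.IdealSheafData.vanishingIdeal (⟨closure T', isClosed_closure⟩ : TopologicalSpace.Closeds F')).subscheme := by
  obtain ⟨F, ρ, T, m, hpre, hND⟩ := h
  -- the ND rounds from the prefix's END STAGE (K6-2P5 l.193 VERBATIM)
  obtain ⟨F', ρ', T', hQ', hreg'⟩ := ND.rounds_resolve n k (ND.NDInvCLNP n k) (ND.ndInvCLNP_end n k) hround m F ρ T hND
  exact ⟨F', ρ', T', prefixReachKeyLetterParam_end_of_prefix_then_rounds (Reach₁ := ReachTowerBTriplePrime)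
    (fun _ _ _ _ _ _ _ _ h₁ => Or.inl h₁) (fun _ _ _ _ _ _ _ _ h₂ => Or.inr h₂) hpre hQ', hreg'⟩

end Junction

/-! ## §R  THE RUNG⁶ (n = 3) -/

/-- **THE RUNG⁶ `nd_leaves_rung_threeP6` (n = 3)** — the 40th cut's theorem: from the KEY-LETTER prefix hypothesis `IsoHypReachNDLeavesP6 k 3 H ι` (a prefix of
point steps / B‴-towers / A⁵ lettered towers / lettered point steps / S10-certified openings / pair rounds / hosted rounds ending at a stage with pointwise ND
leaves) to EL♮'s conclusion, by the K5⁶ engine with the six tree suppliers and the K6-2P6 junction.  Sorry-cone = F-88 only (via `EmbeddedCurveLiftFact`).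
[OURS · L1 W4.5b · rung of the 40th cut; NOT a statement of the manuscript; EL♮(3) NOT proved] -/
theorem nd_leaves_rung_threeP6 (p : ℕ) : EmbeddedCurveLiftFact → p.Prime → ∀ (k : Type) [Field k] [CharP k p] [IsAlgClosed k] (H :
    AlgebraicGeometry.Scheme.{0}) (ι : H ⟶ (Literature.AlgebraicGeometry.Motives.projectiveSpace 3 k).left), AlgebraicGeometry.IsClosedImmersion ι →
    AlgebraicGeometry.IsIntegral H → (∀ y : (Literature.AlgebraicGeometry.Motives.projectiveSpace 3 k).left, ∃ U : (Literature.AlgebraicGeometry.Motives.projectiveSpace 3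
    k).left.affineOpens, y ∈ (U : (Literature.AlgebraicGeometry.Motives.projectiveSpace 3 k).left.Opens) ∧ (ι.ker.ideal U).IsPrincipal) →
    IsoHypReachNDLeavesP6 k 3 H ι → ELNatConclusionO k 3 H ι := by
  intro hFact hp k _ _ _ H ι hι hH hloc h
  exact target_elnat_of_letteredPrefixResolution p hp k 3 H ι hι hH hloc
    -- the four downstairs predicates: Reach := B‴ ∨ toric, ReachL := A⁵, LS := hyperplane letters, Open := the S10 certificate
    (fun F₁ F₂ υ x T₂ F₉ β T₉ => ReachTowerBTriplePrime F₁ F₂ υ x T₂ F₉ β T₉ ∨ ND.ReachToric 3 F₁ F₂ υ x T₂ F₉ β T₉)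
    (ReachTowerBQuintPrime (Literature.AlgebraicGeometry.Motives.projectiveSpace 3 k).left) (HyperplaneLetters k 3 H ι) (OpeningCertKeyLetter k 3 H ι)
    -- HSUB₁(B‴ ∨ toric) by cases: rung P5's block VERBATIM (stub-4's V10⁗-full ∘ (T-k) ∘ res-type-027's `inv_baseSL`; toric towers by `ND.hsub_strataLift`)
    (fun O _ _ _ _ _ θ hθ P q Y Ch hChStep hChSplit hYsp hYirr hYcl hPint hPnoeth hPreg hqprop hqsm X' σ' S' hCh' hX'int hX'noeth hX'reg hX'dom F₁ hF₁ j t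
        hsq T₁ hT₁cl hT₁irr hjT₁ x hx U hU s hs hsU hsx hdim hxreg hsoff X₁ τ₁ hτ₁ hX₁int hX₁noeth hX₁reg hX₁dom F₂ hF₂ υ hυ j₂ t₂ hsq₂ hcomm hcarrier hirr₂ hCh₁ F₉ β T₉ hR =>
      Or.elim hR
        (fun h₁ => hsub_reachTowerBTriplePrime_of_fact_full k O θ hθ P q Y Ch hChStep hChSplit hYsp hYirr hYcl hPint hPnoeth hPreg hqprop hqsm X' σ' S' hCh' hX'int hX'noeth
          hX'reg hX'dom F₁ hF₁ j t hsq T₁ hT₁cl hT₁irr hjT₁ x hx U hU s hs hsU hsx hdim hxreg hsoff X₁ τ₁ hτ₁ hX₁int hX₁noeth hX₁reg hX₁dom F₂ hF₂ υ hυ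
          j₂ t₂ hsq₂ hcomm hcarrier hirr₂ hCh₁ (hFact k O θ hθ P q)
          -- the SL-BASE (plane list seeded `[υ⁻¹{x}]`, conical `W`): res-type-027's `inv_baseSL` (A‴ (U6)), in characteristic `p` of `k`
          (fun W _ hnot _ hcone => by
            haveI : Fact p.Prime := ⟨hp⟩
            haveI := hqprop; haveI := hX'int; haveI := hX'noeth; haveI := hF₁; haveI := hX₁int; haveI := hX₁noeth; haveI := hF₂
            exact inv_baseSL p k O θ hθ P q Y Ch hChSplit hPnoeth hPreg X' σ' S' hCh' hX'reg F₁ j t hsq T₁ x hx hxreg U hU s hs hsU hsx hdim hsoff X₁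
              τ₁ hτ₁ hX₁reg hX₁dom F₂ υ hυ j₂ t₂ hsq₂ hcomm hcarrier hCh₁ hirr₂ W hnot hcone) F₉ β T₉ h₁)
        (fun h₂ => ND.hsub_strataLift k 3 O θ hθ P q Y Ch hChStep hChSplit hYsp hYirr hYcl hPint hPnoeth hPreg hqprop hqsm X' σ' S' hCh' hX'int hX'noeth hX'reg hX'dom F₁ hF₁ j t
          hsq T₁ hT₁cl hT₁irr hjT₁ x hx U hU s hs hsU hsx hdim hxreg hsoff X₁ τ₁ hτ₁ hX₁int hX₁noeth hX₁reg hX₁dom F₂ hF₂ υ hυ j₂ t₂ hsq₂ hcomm hcarrier hirr₂ hCh₁ F₉ β T₉ h₂))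
    -- HSUB₂ (initial stage, hyperplane letters): rung P5's block VERBATIM (stub-4's D3-3 ✓ p655307 V10⁶-full, seeds by res-type-027's lettered bases, letters by (H3) + (H4-T))
    (fun O _ _ _ _ _ θ hθ φ hφ' hφ Ch hChStep hChSplit hYsp hYirr hYcl hPint hPnoeth hPreg hqprop hqsm hCh₀ hdom₀ hF₁int t hsq hT₁cl hT₁irr hjT₁ x hx U hU s hs hsU
        hsx hdim hxreg hsoff X₁ τ₁ hτ₁ hX₁int hX₁noeth hX₁reg hX₁dom F₂ hF₂ υ hυ j₂ t₂ hsq₂ hcomm hcarrier hirr₂ hCh₁ Ls₂ hLS => by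
      haveI : Fact p.Prime := ⟨hp⟩
      -- the graded structures of `O[X₀..X₃]`, `k[X₀..X₃]` (the engine's binder carries it as a `letI`; rung P5 used a local instance attribute)
      letI := MvPolynomial.gradedAlgebra (σ := Fin (3 + 1)) (R := O); letI := MvPolynomial.gradedAlgebra (σ := Fin (3 + 1)) (R := k)
      haveI := hqprop; haveI := hPint; haveI := hPnoeth; haveI := hF₁int; haveI := hX₁int; haveI := hX₁noeth; haveI := hF₂
      -- `ℙⁿ_k` is locally Noetherian: `Proj φ` is a closed immersion into the locally Noetherian `ℙⁿ_O` (base change of `Spec θ`)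
      haveI : IsClosedImmersion (Spec.map (CommRingCat.ofHom θ)) := IsClosedImmersion.spec_of_surjective _ hθ
      have hjci : IsClosedImmersion (Proj.map φ hφ' : (Literature.AlgebraicGeometry.Motives.projectiveSpace 3 k).left ⟶
          Proj (MvPolynomial.homogeneousSubmodule (Fin (3 + 1)) O)) :=
        MorphismProperty.IsStableUnderBaseChange.of_isPullback hsq.flip inferInstance
      have hjfin := ((IsClosedImmersion.iff_isFinite_and_mono _).mp hjci).1
      have hjft := ((IsFinite.iff_isIntegralHom_and_locallyOfFiniteType _).mp hjfin).2
      haveI : IsLocallyNoetherian (Literature.AlgebraicGeometry.Motives.projectiveSpace 3 k).left :=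
        @LocallyOfFiniteType.isLocallyNoetherian _ _ _ hjft hPnoeth
      -- `range ι` is not the point `x` (its strict transform is non-empty)
      have hTx : ¬ Set.range ι ⊆ {x} := by
        obtain ⟨y, hy⟩ := closure_nonempty_iff.mp hirr₂.nonempty
        exact fun h => hy.2 (h hy.1)
      -- the hyperplanes `V₊(ℓ)` are closed (a zero locus of the projective spectrum)
      have hVcl : ∀ ℓ : MvPolynomial (Fin (3 + 1)) k, IsClosed {y : (Literature.AlgebraicGeometry.Motives.projectiveSpace 3 k).left |
          ℓ ∈ (y : ProjectiveSpectrum (MvPolynomial.homogeneousSubmodule (Fin (3 + 1)) k)).asHomogeneousIdeal} := fun ℓ => by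
        have h := ProjectiveSpectrum.isClosed_zeroLocus (MvPolynomial.homogeneousSubmodule (Fin (3 + 1)) k)
          ({ℓ} : Set (MvPolynomial (Fin (3 + 1)) k))
        have hS : {y : ProjectiveSpectrum (MvPolynomial.homogeneousSubmodule (Fin (3 + 1)) k) | ℓ ∈ y.asHomogeneousIdeal} =
            ProjectiveSpectrum.zeroLocus (MvPolynomial.homogeneousSubmodule (Fin (3 + 1)) k) {ℓ} :=
          Set.ext fun y => by simp only [ProjectiveSpectrum.mem_zeroLocus, Set.mem_setOf_eq, Set.singleton_subset_iff, SetLike.mem_coe]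
        rw [← hS] at h
        exact h
      -- the letters' downstairs bookkeeping: closed, not containing the strict transform of `range ι`
      have hLs₂ : ∀ L ∈ Ls₂, IsClosed L ∧ ¬ closure (υ ⁻¹' (Set.range ι \ {x})) ⊆ L := by
        intro L hL
        obtain ⟨ℓ, -, -, -, hHℓ, rfl⟩ := hLS L hL
        exact ⟨isClosed_closure, not_closure_preimage_diff_subset hυ hT₁irr (hVcl ℓ) hx hHℓ hTx
          (Scheme.IdealSheafData.coe_support_vanishingIdeal _).le⟩
      -- the letters' MODEL data at `(X₁, τ₁ ≫ 𝟙, j₂)`: (H3) a hyperplane model through the section, then (H4-T) its strict transform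
      have hLsD : ∀ L ∈ Ls₂, TCPlus.LetterDatum O (Proj (MvPolynomial.homogeneousSubmodule (Fin (3 + 1)) O))
          (Proj.toSpecZero (MvPolynomial.homogeneousSubmodule (Fin (3 + 1)) O) ≫
            Spec.map (CommRingCat.ofHom (algebraMap O (MvPolynomial.homogeneousSubmodule (Fin (3 + 1)) O 0))))
          (Set.range (ι ≫ Proj.map φ hφ')) F₂ X₁ (τ₁ ≫ 𝟙 _) j₂ L := by
        intro L hL
        obtain ⟨ℓ, hℓ1, hℓ0, hxℓ, hHℓ, rfl⟩ := hLS L hL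
        obtain ⟨-, -, fO, hfO', -, -, -, -, h1, h2, h3, h4, h5, hle⟩ :=
          @LinearLetter.exists_letter_model_le_ker O k _ _ _ _ θ hθ 2 φ hφ hφ' s hs x hsx ℓ hℓ1 hℓ0 hxℓ H hH ι hι hHℓ
        have hVne : closure {y : (Literature.AlgebraicGeometry.Motives.projectiveSpace 3 k).left |
            ℓ ∈ (y : ProjectiveSpectrum (MvPolynomial.homogeneousSubmodule (Fin (3 + 1)) k)).asHomogeneousIdeal} ≠ Set.univ := by
          rw [(hVcl ℓ).closure_eq]
          exact fun h => hHℓ (h ▸ Set.subset_univ _)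
        exact letter_strictTransform_of_le_ker k O θ hθ _ _ _ _ (𝟙 _) hPreg _ (Proj.map φ hφ') t hsq x hx s hs hsx X₁ τ₁ hτ₁ F₂ υ hυ j₂ hcomm
          _ _ hVne h1 h2 h3 h4 h5 hle
      exact hsub_reachTowerBQuintPrime_of_fact_full k O θ hθ _ _ _ Ch hChStep hChSplit hYsp hYirr hYcl hPint hPnoeth hPreg hqprop hqsm _ (𝟙 _) _ hCh₀ hPint
        hPnoeth hPreg hdom₀ _ hF₁int (Proj.map φ hφ') t hsq (Set.range ι) hT₁cl hT₁irr hjT₁ x hx U hU s hs hsU hsx hdim hxreg hsoff X₁ τ₁ hτ₁ hX₁int hX₁noeth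
        hX₁reg hX₁dom F₂ hF₂ υ hυ j₂ t₂ hsq₂ hcomm hcarrier hirr₂ hCh₁ Ls₂ hLs₂ (hFact k O θ hθ _ _)
        -- the SL-BASE with letters (conical `W`): res-type-027's `inv_baseSL_letters`, in characteristic `p` of `k`
        (fun W _ hnot _ hcone =>
          inv_baseSL_letters p k O θ hθ _ _ _ Ch hChSplit hPnoeth hPreg _ (𝟙 _) _ hCh₀ hPreg _ (Proj.map φ hφ') t hsq (Set.range ι) x hx hxreg U hU s hs hsU
            hsx hdim hsoff X₁ τ₁ hτ₁ hX₁reg hX₁dom F₂ υ hυ j₂ t₂ hsq₂ hcomm hcarrier hCh₁ hirr₂ W hnot hcone Ls₂ hLsD)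
        -- the S₀L-BASE with letters (shadow-free `W`): res-type-027's `inv_baseS₀L_letters` (char-free)
        (fun W hxW hnot hWpr =>
          inv_baseS₀L_letters k O θ hθ _ _ _ Ch hChSplit hPnoeth hPreg _ (𝟙 _) _ hCh₀ hPreg _ (Proj.map φ hφ') t hsq (Set.range ι) x hx hxreg U hU s hs hsU
            hsx hdim hsoff X₁ τ₁ hτ₁ hX₁reg hX₁dom F₂ υ hυ j₂ t₂ hsq₂ hcomm hcarrier hCh₁ hirr₂ W hxW hnot hWpr Ls₂ hLsD))
    -- HPT⁶ (stub-2 ✓ p670621)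
    (TCPlus.hpt6_supplier k 3)
    -- HOPEN (stub-2 ✓ `TCPlus.hopen_supplier_of₂` p673794 over (IN-1) stub-4's ✓ `TCPlus.opening_birth`, (IN-2) ✓ p672830, (IN-3′) ✓ p673480, (IN-4) ✓ p673307)
    (by
      haveI := hH; haveI := hι
      exact TCPlus.hopen_supplier_of₂ k H ι (TCPlus.opening_birth k H ι) TCPlus.keyInc_pointStep
        (TCPlus.keyInc_carrierRound_of_order k) (TCPlus.crossedLetter_clauses' k))
    -- HPAIR (stub-2 ✓ p670305 over stub-4's (CL) and stub-2's (EB) ✓ p670919 — unconditional)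
    (TCPlus.hpair_supplier_of k (TCPlus.crossedLetter_transport k) (TCPlus.excLetter_birth k))
    -- HROUND (stub-2 ✓ `TCPlus.hround_seam`, from (T-k))
    (TCPlus.hround_seam k hFact)
    -- the K6-2P6 junction: blob + pointwise ND round facts ⇒ the engine's last hypothesis
    (letteredPrefix_end_of_isoHypReachNDLeavesP6 k 3 H ι (ndInvLNP_round 3 k) h)

end Summit.ResolutionOfSingularities.ResolutionOfSingularities.Cruxes.EquisingularLiftNat.Sections

end
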